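import Literature.Topology.FourManifolds.TrisectionsImplantFaceModel
import Literature.Topology.FourManifolds.TrisectionsFaceAmbient
import Literature.Topology.FourManifolds.MorseProofs
import HarnessLib

/-!
# One face through the implant

Topic `Literature/Topology/FourManifolds`; infrastructure for the fact seat
`provefact-Literature.Topology.FourManifolds.exists-14560f9fc8` (named fact (c′)
`Literature.Topology.FourManifolds.exists_stabilized_gkTrisection`, Gay–Kirby 2016, Def. 8 and
Lemma 10).  Everything in this file is **proved**; no definitions, no named facts.

**Theorem (`face_of_implant`).**  The face analogue of `sector_rawPresentation_of_implant`
(`TrisectionsImplantSector.lean`): a face `Q` in normal form (Morse data `Φ, G, λ, Oλ` with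
`λ ≡ λ₀` on an open `Bx ⊇ KX` and no critical point of `G|Q` over the compact carrier `KX` of
the implant) becomes, after the implant, the face `Q'` (`= Q` off `KX`, described in `U` by the
new normal and collar coordinates, with corner-slice charts of the new sector along the new
corner locus `F'`, and a **graph** `x₃ = M(x₀,x₁,x₂)` in the chart `Θ` over the carrier on
which the new collar function `G' = G + λ₀ (col - col')` is `a₀ + b₀ · N`); then `Q'` is a
face in normal form with counts `c n + [n = 1] · #NewCrit`, `NewCrit` the (finite) set of
points of the graph over the critical points of `N` of the right index.  Atlas: permuted
corner charts on `F'`, shear charts on the carrier (`exists_shearChart`), the old charts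
restricted off the carrier; Morse data: regular along `F'` (`not_isMCriticalPt_face_boundary`),
those of `N` on the carrier (`morseData_graphFace`), the old ones elsewhere
(`morseData_transport_sets`).

## References

* D. Gay, R. Kirby, *Trisecting 4-manifolds*, Geom. Topol. 20 (2016), Def. 8, proof of
  Lemma 10. [GayKirby2016]
* J. Milnor, *Morse theory* (1963), §2. [Milnor1963]
-/

open scoped Manifold ContDiff Topology Classical
open Set Function Filter

noncomputable section

namespace Literature.Topology.FourManifolds

universe u

section OneFace

variable {X : Type u} [TopologicalSpace X] [T2Space X]
  [ChartedSpace (EuclideanSpace ℝ (Fin 4)) X] [IsManifold (𝓡 4) ∞ X]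

omit [T2Space X] in
/-- **The critical set of a restriction with isolated critical points on a compact face is
finite.** [cite: Milnor1963, Cor. 2.3] -/
theorem finite_criticalSet_face {Q : Set X} (hQc : IsCompact Q) (Φ : BoundarySliceAtlas 2 Q)
    {G : X → ℝ} (hGs : ContMDiff (𝓡 4) 𝓘(ℝ, ℝ) ∞ G)
    (hnd : letI := Φ.chartedSpace; ∀ p : ↥Q, IsMCriticalPt (𝓡∂ 3) (G ∘ Subtype.val : ↥Q → ℝ) p →
      (mhessian (𝓡∂ 3) (G ∘ Subtype.val : ↥Q → ℝ) p).Nondegenerate) :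
    letI := Φ.chartedSpace
    (criticalSet (𝓡∂ 3) (G ∘ Subtype.val : ↥Q → ℝ)).Finite := by
  letI := Φ.chartedSpace
  haveI := Φ.isManifold
  haveI : CompactSpace ↥Q := isCompact_iff_compactSpace.1 hQc
  have hGval : ContMDiff (𝓡∂ 3) 𝓘(ℝ, ℝ) ∞ (G ∘ Subtype.val : ↥Q → ℝ) := hGs.comp Φ.contMDiff_subtype_val
  set Z := criticalSet (𝓡∂ 3) (G ∘ Subtype.val : ↥Q → ℝ) with hZ
  have hZcl : IsClosed Z := isClosed_criticalSet_of_contMDiff hGval (by norm_cast)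
  have hZc : IsCompact Z := hZcl.isCompact
  have hiso : ∀ p ∈ Z, ∃ W : Set ↥Q, W ∈ 𝓝 p ∧ W ∩ Z ⊆ {p} := by
    intro p hp
    have hev := eventually_not_isMCriticalPt_of_nondegenerate (I := 𝓡∂ 3) hGval (by norm_cast) hp (hnd p hp)
    rw [eventually_nhdsWithin_iff] at hev
    refine ⟨{x | x ∈ ({p}ᶜ : Set ↥Q) → ¬ IsMCriticalPt (𝓡∂ 3) (G ∘ Subtype.val : ↥Q → ℝ) x}, hev, ?_⟩
    rintro x ⟨hx, hxZ⟩
    by_contra hxp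
    exact hx hxp hxZ
  choose! W hW hWZ using hiso
  obtain ⟨t, htZ, hcover⟩ := hZc.elim_nhds_subcover W fun p hp => hW p hp
  refine (t.finite_toSet).subset fun z hz => ?_
  obtain ⟨p, hpt, hzW⟩ := mem_iUnion₂.1 (hcover hz)
  have : z ∈ ({p} : Set ↥Q) := hWZ p (htZ p hpt) ⟨hzW, hz⟩
  rw [mem_singleton_iff.1 this]
  exact hpt

/-- **One face through the implant.**  See the module docstring.
[cite: GayKirby2016, Def. 8 and proof of Lemma 10; Milnor1963, §2] -/
theorem face_of_implant
    -- the chart and the carrier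
    {Θ : OpenPartialHomeomorph X (EuclideanSpace ℝ (Fin 4))}
    (hΘ : Θ ∈ IsManifold.maximalAtlas (𝓡 4) ∞ X)
    {U KX : Set X} (hUo : IsOpen U) (hKXc : IsCompact KX) (hKXU : KX ⊆ U)
    -- the old face and its Morse data (collar coefficient constant on `Bx ⊇ KX`)
    {Q F : Set X} {col : X → ℝ} (hcols : ContMDiff (𝓡 4) 𝓘(ℝ, ℝ) ∞ col)
    (Φ : BoundarySliceAtlas 2 Q) {G lam : X → ℝ} {Ol Bx : Set X} {lam0 : ℝ}
    (hdet : ∀ p : ↥Q, (Φ.datum p).Θ p.1 0 = 0 ↔ p.1 ∈ F)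
    (hGs : ContMDiff (𝓡 4) 𝓘(ℝ, ℝ) ∞ G) (hlams : ContMDiff (𝓡 4) 𝓘(ℝ, ℝ) ∞ lam)
    (hOlo : IsOpen Ol) (hFOl : F ⊆ Ol) (hOlU : Ol ⊆ U) (hlampos : ∀ y ∈ Ol, 0 < lam y)
    (hGform : ∀ y ∈ Ol, G y = 1 - col y * lam y) (hGlt : ∀ p ∈ Q, p ∉ F → G p < 1)
    (hcrit : letI := Φ.chartedSpace
      ∀ p : ↥Q, IsMCriticalPt (𝓡∂ 3) (G ∘ Subtype.val : ↥Q → ℝ) p →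
        p.1 ∉ F ∧ (mhessian (𝓡∂ 3) (G ∘ Subtype.val : ↥Q → ℝ) p).Nondegenerate)
    {c : ℕ → ℕ} (hcount : letI := Φ.chartedSpace
      ∀ n, (criticalSetOfIndex (𝓡∂ 3) (G ∘ Subtype.val : ↥Q → ℝ) n).ncard = c n)
    (hcfin : letI := Φ.chartedSpace; (criticalSet (𝓡∂ 3) (G ∘ Subtype.val : ↥Q → ℝ)).Finite)
    (hBxo : IsOpen Bx) (hKXBx : KX ⊆ Bx) (hBxOl : Bx ⊆ Ol) (hlamconst : ∀ y ∈ Bx, lam y = lam0)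
    (hlam0 : 0 < lam0)
    (hnocritKX : letI := Φ.chartedSpace
      ∀ p : ↥Q, p.1 ∈ KX → ¬ IsMCriticalPt (𝓡∂ 3) (G ∘ Subtype.val : ↥Q → ℝ) p)
    -- the new face
    {Qn Fn : Set X} {nrmN colN : X → ℝ} (hcolNs : ContMDiff (𝓡 4) 𝓘(ℝ, ℝ) ∞ colN)
    (hnrmNs : ContMDiff (𝓡 4) 𝓘(ℝ, ℝ) ∞ nrmN)
    (hQnc : IsCompact Qn) (hFnQn : Fn ⊆ Qn) (hFnU : Fn ⊆ U)
    (hQnU : ∀ y ∈ U, y ∈ Qn ↔ nrmN y = 0 ∧ 0 ≤ colN y)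
    (hFnmem : ∀ y ∈ U, y ∈ Fn ↔ nrmN y = 0 ∧ colN y = 0)
    (hQnQ : ∀ y ∉ KX, y ∈ Qn ↔ y ∈ Q) (hFnF : ∀ y ∉ KX, y ∈ Fn ↔ y ∈ F)
    (hcolN : ∀ y ∉ KX, colN y = col y)
    {SaN : Set X} {ρN : X → X}
    (hcornerN : ∀ x ∈ Fn, ∃ C : CornerSliceChart SaN Fn nrmN colN ρN, x ∈ C.Θ.source ∧ C.Θ.source ⊆ U)
    -- the graph description over the carrier
    {V : Set X} (hVo : IsOpen V) (hVsrc : V ⊆ Θ.source)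
    (hKXV : ∀ y ∈ Qn, y ∈ KX → y ∉ Fn → y ∈ V)
    {M Nf : EuclideanSpace ℝ (Fin 3) → ℝ} (hM : ContDiff ℝ ∞ M) (hNf : ContDiff ℝ ∞ Nf)
    (hgraph : ∀ q ∈ V, q ∈ Qn ↔ Θ q 3 = M (dropLast 2 (Θ q)))
    {a₀ b₀ : ℝ} (hb₀ : b₀ ≠ 0)
    (hGNgraph : ∀ q ∈ V, q ∈ Qn → G q + lam0 * (col q - colN q) = a₀ + b₀ * Nf (dropLast 2 (Θ q)))
    {NewCrit : Set X}
    (hNCdef : ∀ q, q ∈ NewCrit ↔ q ∈ Qn ∧ q ∈ KX ∧ q ∉ Fn ∧ IsMCriticalPt (𝓡 3) Nf (dropLast 2 (Θ q)))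
    (hNCfin : NewCrit.Finite)
    (hNCdata : ∀ q ∈ NewCrit, (mhessian (𝓡 3) Nf (dropLast 2 (Θ q))).Nondegenerate ∧
      (0 < b₀ → morseIndex (𝓡 3) Nf (dropLast 2 (Θ q)) = 1) ∧
      (b₀ < 0 → morseIndex (𝓡 3) Nf (dropLast 2 (Θ q)) = 2)) :
    FaceNormalForm Qn Fn nrmN colN U (fun n => c n + if n = 1 then NewCrit.ncard else 0) := by
  letI instQ := Φ.chartedSpace
  haveI := Φ.isManifold
  have hKXcl : IsClosed KX := hKXc.isClosed
  have hKXOl : KX ⊆ Ol := hKXBx.trans hBxOl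
  -- ### the new ambient function
  set GN : X → ℝ := fun y => G y + lam0 * (col y - colN y) with hGN
  have hGNs : ContMDiff (𝓡 4) 𝓘(ℝ, ℝ) ∞ GN := hGs.add (contMDiff_const.mul (hcols.sub hcolNs))
  have hGN_off : ∀ y ∉ KX, GN y = G y := fun y hy => by
    simp only [hGN, hcolN y hy, sub_self, mul_zero, add_zero]
  have hGN_far : ∀ y ∉ KX, GN =ᶠ[𝓝 y] G := fun y hy => by
    filter_upwards [hKXcl.isOpen_compl.mem_nhds hy] with w hw using hGN_off w hw
  have hGN_Bx : ∀ y ∈ Bx, GN y = 1 - colN y * lam y := fun y hy => by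
    simp only [hGN, hGform y (hBxOl hy), hlamconst y hy]; ring
  -- the new region of the collar form
  set OlN : Set X := Ol ∩ (KXᶜ ∪ Bx) with hOlN
  have hOlNo : IsOpen OlN := hOlo.inter (hKXcl.isOpen_compl.union hBxo)
  have hFnOlN : Fn ⊆ OlN := by
    intro y hy
    by_cases hyK : y ∈ KX
    · exact ⟨hBxOl (hKXBx hyK), Or.inr (hKXBx hyK)⟩
    · exact ⟨hFOl ((hFnF y hyK).1 hy), Or.inl hyK⟩
  have hOlNU : OlN ⊆ U := fun y hy => hOlU hy.1
  have hGNform : ∀ y ∈ OlN, GN y = 1 - colN y * lam y := by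
    rintro y ⟨hyOl, hyK | hyB⟩
    · have hyK' : y ∉ KX := hyK
      rw [hGN_off y hyK', hGform y hyOl, hcolN y hyK']
    · exact hGN_Bx y hyB
  have hGNlt : ∀ p ∈ Qn, p ∉ Fn → GN p < 1 := by
    intro p hpQn hpFn
    by_cases hpK : p ∈ KX
    · have hpU : p ∈ U := hKXU hpK
      obtain ⟨hn0, hc0⟩ := (hQnU p hpU).1 hpQn
      have hcpos : 0 < colN p := lt_of_le_of_ne hc0 fun h0 => hpFn ((hFnmem p hpU).2 ⟨hn0, h0.symm⟩)
      rw [hGN_Bx p (hKXBx hpK), hlamconst p (hKXBx hpK)]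
      nlinarith [mul_pos hcpos hlam0]
    · rw [hGN_off p hpK]
      exact hGlt p ((hQnQ p hpK).1 hpQn) fun hpF => hpFn ((hFnF p hpK).2 hpF)
  -- ### the charts of the new face
  -- on `Fn`: from the new corner-slice charts
  have hDF : ∀ x ∈ Fn, ∃ D : BoundarySliceChart 2 Qn, x ∈ D.Θ.source ∧
      ∀ q ∈ D.Θ.source, D.Θ q 0 = colN q := by
    intro x hx
    obtain ⟨C, hxC, hCU⟩ := hcornerN x hx
    obtain ⟨D, hDsrc, hDcoord⟩ :=
      exists_boundarySliceChart_of_cornerSliceChart (Q := Qn) C fun q hq => hQnU q (hCU hq)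
    refine ⟨D, by rw [hDsrc]; exact hxC, fun q hq => ?_⟩
    rw [(hDcoord q).1, C.apply_one q (by rw [← hDsrc]; exact hq)]
  choose DF hDFmem hDF0 using hDF
  -- on the carrier, off `Fn`: shear charts
  have hDK : ∀ y ∈ V, ∃ D : BoundarySliceChart 2 Qn, y ∈ D.Θ.source ∧ D.Θ.source ⊆ V ∧
      ∀ q ∈ D.Θ.source, 0 < D.Θ q 0 := by
    intro y hyV
    obtain ⟨D, hyD, hDV, hpos, -⟩ := exists_shearChart (Q' := Qn) hΘ hM hVo hVsrc hgraph hyV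
    exact ⟨D, hyD, hDV, hpos⟩
  choose DK hDKmem hDKV hDKpos using hDK
  -- off the carrier: the old charts, restricted
  have hDO : ∀ p : ↥Q, ∃ D : BoundarySliceChart 2 Qn, D.Θ.source = (Φ.datum p).Θ.source ∩ KXᶜ ∧
      D.Θ.target ⊆ (Φ.datum p).Θ.target ∧ (∀ q, D.Θ q = (Φ.datum p).Θ q) ∧
      ∀ z, D.Θ.symm z = (Φ.datum p).Θ.symm z := fun p =>
    exists_boundarySliceChart_of_inter_eq' (Φ.datum p) hKXcl.isOpen_compl fun q hq => (hQnQ q hq).symm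
  choose DO hDOsrc hDOtgt hDOcoe hDOsymm using hDO
  -- membership facts
  have hQ_of : ∀ p : ↥Qn, p.1 ∉ KX → p.1 ∈ Q := fun p hp => (hQnQ p.1 hp).1 p.2
  -- the atlas
  set datum : ↥Qn → BoundarySliceChart 2 Qn := fun p =>
    if hF : p.1 ∈ Fn then DF p.1 hF
    else if hK : p.1 ∈ KX then DK p.1 (hKXV p.1 p.2 hK hF)
    else DO ⟨p.1, hQ_of p hK⟩ with hdatum
  have hdatumF : ∀ (p : ↥Qn) (hF : p.1 ∈ Fn), datum p = DF p.1 hF := fun p hF => by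
    simp only [hdatum, hF, dif_pos]
  have hdatumK : ∀ (p : ↥Qn) (hF : p.1 ∉ Fn) (hK : p.1 ∈ KX), datum p = DK p.1 (hKXV p.1 p.2 hK hF) := fun p hF hK => by
    simp only [hdatum, hF, dif_neg, not_false_eq_true, hK, dif_pos]
  have hdatumO : ∀ (p : ↥Qn) (hF : p.1 ∉ Fn) (hK : p.1 ∉ KX), datum p = DO ⟨p.1, hQ_of p hK⟩ := fun p hF hK => by
    simp only [hdatum, hF, dif_neg, not_false_eq_true, hK]
  have hmem_source : ∀ p : ↥Qn, p.1 ∈ (datum p).Θ.source := by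
    intro p
    by_cases hF : p.1 ∈ Fn
    · rw [hdatumF p hF]; exact hDFmem p.1 hF
    · by_cases hK : p.1 ∈ KX
      · rw [hdatumK p hF hK]; exact hDKmem p.1 _
      · rw [hdatumO p hF hK, hDOsrc]; exact ⟨Φ.mem_source _, hK⟩
  set Φn : BoundarySliceAtlas 2 Qn := ⟨datum, hmem_source⟩ with hΦn
  have hΦndatum : ∀ p, Φn.datum p = datum p := fun p => rfl
  letI instQn := Φn.chartedSpace
  haveI := Φn.isManifold
  -- boundary detection
  have hdetect : ∀ p : ↥Qn, (Φn.datum p).Θ p.1 0 = 0 ↔ p.1 ∈ Fn := by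
    intro p
    rw [hΦndatum]
    by_cases hF : p.1 ∈ Fn
    · rw [hdatumF p hF, hDF0 p.1 hF p.1 (hDFmem p.1 hF)]
      have : colN p.1 = 0 := ((hFnmem p.1 (hFnU hF)).1 hF).2
      exact ⟨fun _ => hF, fun _ => this⟩
    · by_cases hK : p.1 ∈ KX
      · rw [hdatumK p hF hK]
        have h := hDKpos p.1 (hKXV p.1 p.2 hK hF) p.1 (hDKmem p.1 _)
        exact ⟨fun h0 => absurd h0 h.ne', fun h' => absurd h' hF⟩
      · rw [hdatumO p hF hK, hDOcoe]
        rw [hdet ⟨p.1, hQ_of p hK⟩, ← hFnF p.1 hK]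
  -- ### Morse data: no critical points on `Fn`
  have hnocritF : ∀ p : ↥Qn, p.1 ∈ Fn → ¬ IsMCriticalPt (𝓡∂ 3) (GN ∘ Subtype.val : ↥Qn → ℝ) p := by
    intro p hp
    refine not_isMCriticalPt_face_boundary Φn p (va := colN) (lam := lam) ?_ ?_ hGNs hlams ?_ ?_
    · intro q hq
      rw [hΦndatum, hdatumF p hp] at hq ⊢
      exact hDF0 p.1 hp q hq
    · exact ((hFnmem p.1 (hFnU hp)).1 hp).2
    · filter_upwards [hOlNo.mem_nhds (hFnOlN hp)] with y hy using hGNform y hy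
    · exact (hlampos p.1 (hFnOlN hp).1).ne'
  -- ### Morse data on the carrier
  have hGNgraph' : ∀ q ∈ V, q ∈ Qn → GN q = a₀ + b₀ * Nf (dropLast 2 (Θ q)) := fun q hq hqQ => hGNgraph q hq hqQ
  have hcarrier : ∀ p : ↥Qn, p.1 ∈ KX → (hF : p.1 ∉ Fn) →
      (IsMCriticalPt (𝓡∂ 3) (GN ∘ Subtype.val : ↥Qn → ℝ) p ↔ IsMCriticalPt (𝓡 3) Nf (dropLast 2 (Θ p.1))) ∧
      (IsMCriticalPt (𝓡∂ 3) (GN ∘ Subtype.val : ↥Qn → ℝ) p →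
        ((mhessian (𝓡∂ 3) (GN ∘ Subtype.val : ↥Qn → ℝ) p).Nondegenerate ↔
          (mhessian (𝓡 3) Nf (dropLast 2 (Θ p.1))).Nondegenerate) ∧
        (0 < b₀ → morseIndex (𝓡∂ 3) (GN ∘ Subtype.val : ↥Qn → ℝ) p = morseIndex (𝓡 3) Nf (dropLast 2 (Θ p.1))) ∧
        (b₀ < 0 → (mhessian (𝓡 3) Nf (dropLast 2 (Θ p.1))).Nondegenerate →
          morseIndex (𝓡∂ 3) (GN ∘ Subtype.val : ↥Qn → ℝ) p + morseIndex (𝓡 3) Nf (dropLast 2 (Θ p.1)) = 3)) := by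
    intro p hK hF
    obtain ⟨-, -, -, -, h⟩ := morseData_graphFace (Q' := Qn) hΘ hM Φn hVo hVsrc hgraph hGNs hNf hb₀ hGNgraph'
      (hKXV p.1 p.2 hK hF) p.2
    exact h
  -- ### Morse data off the carrier (transport from the old face)
  have hoff : ∀ p : ↥Qn, (hK : p.1 ∉ KX) → p.1 ∉ Fn →
      (IsMCriticalPt (𝓡∂ 3) (G ∘ Subtype.val : ↥Q → ℝ) ⟨p.1, hQ_of p hK⟩ ↔
        IsMCriticalPt (𝓡∂ 3) (GN ∘ Subtype.val : ↥Qn → ℝ) p) ∧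
      (IsMCriticalPt (𝓡∂ 3) (G ∘ Subtype.val : ↥Q → ℝ) ⟨p.1, hQ_of p hK⟩ →
        ((mhessian (𝓡∂ 3) (G ∘ Subtype.val : ↥Q → ℝ) ⟨p.1, hQ_of p hK⟩).Nondegenerate ↔
          (mhessian (𝓡∂ 3) (GN ∘ Subtype.val : ↥Qn → ℝ) p).Nondegenerate) ∧
        morseIndex (𝓡∂ 3) (G ∘ Subtype.val : ↥Q → ℝ) ⟨p.1, hQ_of p hK⟩ =
          morseIndex (𝓡∂ 3) (GN ∘ Subtype.val : ↥Qn → ℝ) p) := by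
    intro p hK hF
    have hpQ : p.1 ∈ Q := hQ_of p hK
    have hpF : p.1 ∉ F := fun h => hF ((hFnF p.1 hK).2 h)
    set pQ : ↥Q := ⟨p.1, hpQ⟩ with hpQdef
    set D₀ := Φ.datum pQ with hD₀
    have hpD₀ : p.1 ∈ D₀.Θ.source := Φ.mem_source pQ
    have h0 : 0 < D₀.Θ p.1 0 := by
      have hne : D₀.Θ p.1 0 ≠ 0 := fun h => hpF ((hdet pQ).1 h)
      exact lt_of_le_of_ne (D₀.apply_zero_nonneg hpD₀ hpQ) (Ne.symm hne)
    have hres := morseData_transport_sets Φ Φn D₀ (DO pQ) (hDOcoe pQ) (hDOsymm pQ)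
      hpQ p.2 hpD₀ (by rw [hDOsrc]; exact ⟨hpD₀, hK⟩) h0 hGs hGNs (hGN_far p.1 hK)
    exact hres
  -- ### the Morse clause
  have hmorse : ∀ p : ↥Qn, IsMCriticalPt (𝓡∂ 3) (GN ∘ Subtype.val : ↥Qn → ℝ) p →
      p.1 ∉ Fn ∧ (mhessian (𝓡∂ 3) (GN ∘ Subtype.val : ↥Qn → ℝ) p).Nondegenerate := by
    intro p hcr
    have hF : p.1 ∉ Fn := fun h => hnocritF p h hcr
    refine ⟨hF, ?_⟩
    by_cases hK : p.1 ∈ KX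
    · obtain ⟨h1, h2⟩ := hcarrier p hK hF
      have hNfcrit := h1.1 hcr
      have hNC : p.1 ∈ NewCrit := (hNCdef p.1).2 ⟨p.2, hK, hF, hNfcrit⟩
      exact ((h2 hcr).1).2 (hNCdata p.1 hNC).1
    · obtain ⟨h1, h2⟩ := hoff p hK hF
      have hold := h1.2 hcr
      exact ((h2 hold).1).1 (hcrit _ hold).2
  -- ### the index of the new critical points is `1`
  have hnewindex : ∀ p : ↥Qn, p.1 ∈ KX → (hF : p.1 ∉ Fn) →
      IsMCriticalPt (𝓡∂ 3) (GN ∘ Subtype.val : ↥Qn → ℝ) p →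
      p.1 ∈ NewCrit ∧ morseIndex (𝓡∂ 3) (GN ∘ Subtype.val : ↥Qn → ℝ) p = 1 := by
    intro p hK hF hcr
    obtain ⟨h1, h2⟩ := hcarrier p hK hF
    have hNfcrit := h1.1 hcr
    have hNC : p.1 ∈ NewCrit := (hNCdef p.1).2 ⟨p.2, hK, hF, hNfcrit⟩
    obtain ⟨hnd, hipos, hineg⟩ := hNCdata p.1 hNC
    obtain ⟨-, h2b, h2c⟩ := h2 hcr
    refine ⟨hNC, ?_⟩
    rcases lt_or_gt_of_ne hb₀ with hneg | hpos
    · have h := h2c hneg hnd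
      rw [hineg hneg] at h
      omega
    · rw [h2b hpos, hipos hpos]
  -- ### the counts
  have hcounts : ∀ n, (criticalSetOfIndex (𝓡∂ 3) (GN ∘ Subtype.val : ↥Qn → ℝ) n).ncard =
      c n + if n = 1 then NewCrit.ncard else 0 := by
    intro n
    set A : Set X := Subtype.val '' criticalSetOfIndex (𝓡∂ 3) (GN ∘ Subtype.val : ↥Qn → ℝ) n with hA
    set B : Set X := Subtype.val '' criticalSetOfIndex (𝓡∂ 3) (G ∘ Subtype.val : ↥Q → ℝ) n with hB
    have hAcard : (criticalSetOfIndex (𝓡∂ 3) (GN ∘ Subtype.val : ↥Qn → ℝ) n).ncard = A.ncard :=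
      (Set.ncard_image_of_injective _ Subtype.val_injective).symm
    have hBcard : B.ncard = c n := by
      rw [hB, Set.ncard_image_of_injective _ Subtype.val_injective, hcount n]
    have hBfin : B.Finite := (hcfin.subset (criticalSetOfIndex_subset _ _ _)).image _
    have hBKX : ∀ y ∈ B, y ∉ KX := by
      rintro _ ⟨q, hq, rfl⟩ hK
      exact hnocritKX q hK hq.1
    have hNCKX : ∀ y ∈ NewCrit, y ∈ KX := fun y hy => ((hNCdef y).1 hy).2.1
    -- the set identity
    have hset : A = B ∪ (if n = 1 then NewCrit else ∅) := by
      ext y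
      simp only [hA, hB, mem_union, mem_image, mem_criticalSetOfIndex]
      constructor
      · rintro ⟨p, ⟨hcr, hidx⟩, rfl⟩
        have hF : p.1 ∉ Fn := (hmorse p hcr).1
        by_cases hK : p.1 ∈ KX
        · obtain ⟨hNC, hi1⟩ := hnewindex p hK hF hcr
          right
          have hn : n = 1 := by rw [← hidx, hi1]
          subst hn
          simpa using hNC
        · obtain ⟨h1, h2⟩ := hoff p hK hF
          have hold := h1.2 hcr
          left
          exact ⟨⟨p.1, hQ_of p hK⟩, ⟨hold, by rw [(h2 hold).2]; exact hidx⟩, rfl⟩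
      · rintro (⟨q, ⟨hcr, hidx⟩, rfl⟩ | hy)
        · have hK : q.1 ∉ KX := fun hK => hnocritKX q hK hcr
          have hqQn : q.1 ∈ Qn := (hQnQ q.1 hK).2 q.2
          have hqF : q.1 ∉ F := (hcrit q hcr).1
          have hqFn : q.1 ∉ Fn := fun h => hqF ((hFnF q.1 hK).1 h)
          set p : ↥Qn := ⟨q.1, hqQn⟩ with hp
          obtain ⟨h1, h2⟩ := hoff p hK hqFn
          have hqeq : (⟨p.1, hQ_of p hK⟩ : ↥Q) = q := Subtype.ext rfl
          rw [hqeq] at h1 h2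
          refine ⟨p, ⟨h1.1 hcr, ?_⟩, rfl⟩
          rw [← (h2 hcr).2]; exact hidx
        · by_cases hn : n = 1
          · subst hn
            simp only [if_true] at hy
            obtain ⟨hyQn, hyK, hyFn, hyNf⟩ := (hNCdef y).1 hy
            set p : ↥Qn := ⟨y, hyQn⟩ with hp
            have hcr : IsMCriticalPt (𝓡∂ 3) (GN ∘ Subtype.val : ↥Qn → ℝ) p := (hcarrier p hyK hyFn).1.2 hyNf
            obtain ⟨-, hi1⟩ := hnewindex p hyK hyFn hcr
            exact ⟨p, ⟨hcr, hi1⟩, rfl⟩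
          · simp only [hn, if_false, mem_empty_iff_false] at hy
    have hdisj : Disjoint B (if n = 1 then NewCrit else ∅) := by
      rw [Set.disjoint_left]
      intro y hyB hy
      split_ifs at hy with hn
      · exact hBKX y hyB (hNCKX y hy)
      · exact hy
    have hfin2 : (if n = 1 then NewCrit else ∅ : Set X).Finite := by
      split_ifs
      · exact hNCfin
      · exact finite_empty
    rw [hAcard, hset, Set.ncard_union_eq hdisj hBfin hfin2, hBcard]
    split_ifs with hn
    · rfl
    · rw [ncard_empty]
  -- ### the normal form
  exact
    { isCompact := hQnc
      F_subset := hFnQn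
      F_subset_U := hFnU
      isOpen_U := hUo
      mem_iff := hQnU
      memF_iff := hFnmem
      contMDiff_nrm := hnrmNs
      contMDiff_col := hcolNs
      morse := ⟨Φn, GN, lam, OlN, hdetect, hGNs, hlams, hOlNo, hFnOlN, hOlNU,
        fun y hy => hlampos y hy.1, hGNform, hGNlt, hmorse, hcounts⟩ }


end OneFace

end Literature.Topology.FourManifolds
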